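import Mathlib
import HarnessLib

/-!
# Andrews' trace-ABP gadget (Andrews 2022, Lemma 8), I: the matrix and its leading minors

Topic `Literature/Computability/AlgebraicComplexity`. Fifth support file for the formalisation of
Andrews 2022, Theorem 3 (`DeterminantalIdealComplexity.lean`). Andrews' Lemma 8: for matrices of
variables `X⁽¹⁾, …, X⁽ᵐ⁾` (`X⁽ⁱ⁾` of size `nᵢ × nᵢ₊₁`, `n₁ = n_{m+1}`, `N = Σ nᵢ`) and a
non-increasing `σ` with `σ₁ ≥ N` there is a matrix `M` over `F(ε)[X]`, each entry a constant or a
scalar multiple of a variable, with `∏ᵢ det(M_{[σᵢ],[σᵢ]}) = 1 + ε tr(X⁽¹⁾ ⋯ X⁽ᵐ⁾) + O(ε²)`.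
Theorem 3 uses the case `m = 3`, `n₁ = n₂ = n₃ = n₄ = t` (`tr(XYZ)`, `N = 4t`), which is what we
formalise, over an arbitrary commutative ring `S` with a distinguished element `δ` (later `δ = ε`).

Following the printed proof, `M'` is the adjacency matrix of the layered graph computing `tr(XYZ)`
with self-loops of weight `1` and feedback edges `tᵢ → sᵢ` of weight `δ`:

  `M' = [[I, D·X, 0, 0], [0, I, Y, 0], [0, 0, I, Z], [δ I, 0, 0, I]]`  (blocks of size `t`),

where the diagonal rescaling `D = diag(c₀, …, c_{t-1})` of the first variable block is Andrews'
change of variables `X⁽¹⁾ ↦ (-1)^{m+1} A X⁽¹⁾` folded into the matrix; rows and columns `≥ 4t` are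
padded with the identity (the case `σ₁ > N` of the printed proof). This file computes the leading
principal minors to first order in `δ`:

* `gad t c δ x y` — the `(x, y)` entry (`x, y ∈ ℕ`) and `M t c δ k` — the leading `k × k` corner;
  `M = 1 + A + δ • B` with `A` the strictly block-superdiagonal (variable) part and `B` the feedback
  pattern (`M_eq`).
* `A` raises the block index `x ↦ x / t` by exactly one, hence `A⁴ = 0` (`A_pow_four`), `1 + A` is
  upper unitriangular with `det (1 + A) = 1` (`det_one_add_A`) and inverse `Q = 1 - A + A² - A³`
  (`one_add_A_mul_Q`).
* `det_M_eq` — `det M_{[k]} = 1 + δ · tr(Q B) + δ² · r` for some `r` (from `M = (1 + A)(1 + δ Q B)`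
  and Mathlib's `Matrix.det_one_add_smul`), the first-order expansion behind the cycle-cover count
  of the printed proof. The trace `tr(Q B) = -Σᵢ cᵢ (XYZ)ᵢᵢ` (restricted to the feedback edges
  present in the corner) is evaluated in `TraceGadgetTrace.lean`.

## References

* [Andrews2022] R. Andrews, *On Matrix Multiplication and Polynomial Identity Testing*, FOCS 2022,
  arXiv:2208.01078, Lemma 8 and its proof (§3).
-/

noncomputable section

open MvPolynomial Matrix

namespace Literature.Computability.AlgebraicComplexity

namespace TraceGadget

universe u u'

/-- The variables of the gadget: the entries of three `t × t` matrices `X = Z⁽¹⁾`, `Y = Z⁽²⁾`,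
`Z = Z⁽³⁾` (`inl (κ,μ) ↦ x_{κμ}`, `inr (inl (μ,ν)) ↦ y_{μν}`, `inr (inr (ν,κ)) ↦ z_{νκ}`).
[cite: Andrews2022, Lemma 8] -/
abbrev Var (t : ℕ) : Type := (Fin t × Fin t) ⊕ ((Fin t × Fin t) ⊕ (Fin t × Fin t))

variable {S : Type u} [CommRing S] (t : ℕ) [NeZero t] (c : Fin t → S) (δ : S)

/-- Offsets inside a block: `x ↦ x mod t` as an element of `Fin t`. [folklore] -/
def modFin (x : ℕ) : Fin t := ⟨x % t, Nat.mod_lt x (Nat.pos_of_ne_zero (NeZero.ne t))⟩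

/-- `modFin` on a natural number `< t`. [folklore] -/
@[simp] theorem modFin_of_lt {t : ℕ} [NeZero t] {x : ℕ} (hx : x < t) : modFin t x = ⟨x, hx⟩ :=
  Fin.ext (Nat.mod_eq_of_lt hx)

/-- `modFin` is `t`-periodic. [folklore] -/
@[simp] theorem modFin_mul_add {t : ℕ} [NeZero t] (b x : ℕ) : modFin t (t * b + x) = modFin t x :=
  Fin.ext (by simp [modFin])

/-- Edge labels of the layered graph: an edge from block `b` (vertex `x`) to block `b + 1`
(vertex `y`) carries `c_x · x_{x,y}` (`b = 0`, the rescaled first matrix), `y_{x,y}` (`b = 1`) or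
`z_{x,y}` (`b = 2`); indices are read modulo `t` (offsets inside the blocks).
[cite: Andrews2022, Lemma 8 (proof)] -/
def lab (b x y : ℕ) : MvPolynomial (Var t) S :=
  if b = 0 then C (c (modFin t x)) * X (Sum.inl (modFin t x, modFin t y))
  else if b = 1 then X (Sum.inr (Sum.inl (modFin t x, modFin t y)))
  else X (Sum.inr (Sum.inr (modFin t x, modFin t y)))

/-- The strictly block-superdiagonal part `A` of the gadget: entry `(x, y)` is an edge label iff
`y` lies in the block after the block of `x` (blocks `= ⌊·/t⌋ ∈ {0,1,2,3}`), else `0`.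
[cite: Andrews2022, Lemma 8 (proof)] -/
def upper (x y : ℕ) : MvPolynomial (Var t) S :=
  if y / t = x / t + 1 ∧ y < 4 * t then lab t c (x / t) x y else 0

/-- The feedback pattern `B`: the indicator of the edges `t_i → s_i`, i.e. of the positions
`(3t + i, i)`, `i < t`. [cite: Andrews2022, Lemma 8 (proof)] -/
def feedback (S : Type u) [CommRing S] (t x y : ℕ) : MvPolynomial (Var t) S :=
  if x = y + 3 * t ∧ y < t then 1 else 0

/-- **The gadget matrix entries** `M'_{x,y} = [x = y] + A_{x,y} + δ B_{x,y}` (`x, y ∈ ℕ`; rows and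
columns `≥ 4t` only carry the diagonal `1`). [cite: Andrews2022, Lemma 8 (proof)] -/
def gad (x y : ℕ) : MvPolynomial (Var t) S :=
  (if x = y then 1 else 0) + upper t c x y + C δ * feedback S t x y

/-- The leading `k × k` corner `M'_{[k],[k]}` of the gadget. [cite: Andrews2022, Lemma 8 (proof)] -/
def M (k : ℕ) : Matrix (Fin k) (Fin k) (MvPolynomial (Var t) S) :=
  Matrix.of fun x y => gad t c δ x y

/-- The corner of `A`. [cite: Andrews2022, Lemma 8 (proof)] -/
def A (k : ℕ) : Matrix (Fin k) (Fin k) (MvPolynomial (Var t) S) :=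
  Matrix.of fun x y => upper t c x y

/-- The corner of `B`. [cite: Andrews2022, Lemma 8 (proof)] -/
def B (S : Type u) [CommRing S] (t k : ℕ) : Matrix (Fin k) (Fin k) (MvPolynomial (Var t) S) :=
  Matrix.of fun x y => feedback S t (x : ℕ) (y : ℕ)

/-- The candidate inverse `Q = 1 - A + A² - A³` of `1 + A`. [cite: Andrews2022, Lemma 8 (proof)] -/
def Q (k : ℕ) : Matrix (Fin k) (Fin k) (MvPolynomial (Var t) S) :=
  1 - A t c k + A t c k ^ 2 - A t c k ^ 3

variable {t c δ}

/-! ### Change of scalars -/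

/-- `feedback` has integer entries. [cite: Andrews2022, Lemma 8 (proof)] -/
theorem map_feedback {S' : Type u'} [CommRing S'] (φ : S →+* S') (t x y : ℕ) :
    MvPolynomial.map φ (feedback S t x y) = feedback S' t x y := by
  unfold feedback
  split_ifs <;> simp

/-- Change of scalars in the gadget entries: apply `φ` to `c` and `δ`. [cite: Andrews2022, Lemma 8 (proof)] -/
theorem map_gad {S' : Type u'} [CommRing S'] (φ : S →+* S') (x y : ℕ) :
    MvPolynomial.map φ (gad t c δ x y) = gad t (φ ∘ c) (φ δ) x y := by
  unfold gad upper lab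
  rw [map_add, map_add, map_mul, map_C, map_feedback]
  congr 1
  · congr 1
    · split_ifs <;> simp
    · split_ifs <;> simp [map_X]

/-! ### `M = 1 + A + δ B`, and `A` is graded by the block index -/

/-- The decomposition `M_{[k]} = 1 + A + δ • B`. [cite: Andrews2022, Lemma 8 (proof)] -/
theorem M_eq (k : ℕ) :
    M t c δ k = 1 + A t c k + (C δ : MvPolynomial (Var t) S) • B S t k := by
  refine Matrix.ext fun x y => ?_
  simp only [M, A, B, gad, Matrix.add_apply, Matrix.of_apply, Matrix.one_apply, Matrix.smul_apply,
    smul_eq_mul, Fin.ext_iff]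

/-- `A_{x,y} ≠ 0` forces `y` to lie in the block after `x`'s, below `4t`.
[cite: Andrews2022, Lemma 8 (proof)] -/
theorem upper_ne_zero {x y : ℕ} (h : upper t c x y ≠ 0) : y / t = x / t + 1 ∧ y < 4 * t := by
  unfold upper at h
  by_contra hc
  exact h (if_neg hc)

/-- A graded matrix: powers raise the grading. [folklore] -/
theorem pow_apply_ne_zero {k : ℕ} {R : Type u'} [CommRing R] (N : Matrix (Fin k) (Fin k) R)
    (g : Fin k → ℕ) (hN : ∀ x y, N x y ≠ 0 → g y = g x + 1) :
    ∀ (p : ℕ) (x y : Fin k), (N ^ p) x y ≠ 0 → g y = g x + p := by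
  intro p
  induction p with
  | zero =>
    intro x y h
    rw [pow_zero, Matrix.one_apply] at h
    by_cases hxy : x = y
    · subst hxy
      simp
    · exact absurd (if_neg hxy) h
  | succ p ih =>
    intro x y h
    rw [pow_succ, Matrix.mul_apply] at h
    obtain ⟨z, -, hz⟩ := Finset.exists_ne_zero_of_sum_ne_zero h
    have h1 : (N ^ p) x z ≠ 0 := fun h0 => hz (by rw [h0, zero_mul])
    have h2 : N z y ≠ 0 := fun h0 => hz (by rw [h0, mul_zero])
    rw [hN z y h2, ih x z h1]
    ring

/-- Entries of `A^{p+1}` vanish outside the first `4t` columns. [cite: Andrews2022, Lemma 8 (proof)] -/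
theorem A_pow_succ_apply_eq_zero {k : ℕ} (p : ℕ) (x y : Fin k) (hy : 4 * t ≤ (y : ℕ)) :
    (A t c k ^ (p + 1)) x y = 0 := by
  by_contra h
  rw [pow_succ, Matrix.mul_apply] at h
  obtain ⟨z, -, hz⟩ := Finset.exists_ne_zero_of_sum_ne_zero h
  have h2 : A t c k z y ≠ 0 := fun h0 => hz (by rw [h0, mul_zero])
  have := (upper_ne_zero (t := t) (c := c) h2).2
  omega

/-- The grading statement for `A`: `(A^p)_{x,y} ≠ 0 ⟹ ⌊y/t⌋ = ⌊x/t⌋ + p`.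
[cite: Andrews2022, Lemma 8 (proof)] -/
theorem A_pow_apply_ne_zero {k : ℕ} (p : ℕ) (x y : Fin k) (h : (A t c k ^ p) x y ≠ 0) :
    (y : ℕ) / t = (x : ℕ) / t + p :=
  pow_apply_ne_zero (A t c k) (fun z => (z : ℕ) / t)
    (fun _ _ hxy => (upper_ne_zero (t := t) (c := c) hxy).1) p x y h

/-- **`A⁴ = 0`**: every path in the layered graph has length `≤ 3`. [cite: Andrews2022, Lemma 8 (proof)] -/
theorem A_pow_four (k : ℕ) : A t c k ^ 4 = 0 := by
  refine Matrix.ext fun x y => ?_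
  rw [Matrix.zero_apply]
  by_cases hy : 4 * t ≤ (y : ℕ)
  · exact A_pow_succ_apply_eq_zero 3 x y hy
  · by_contra h
    have hg := A_pow_apply_ne_zero 4 x y h
    have ht : 0 < t := Nat.pos_of_ne_zero (NeZero.ne t)
    have h4 : 4 ≤ (y : ℕ) / t := by
      rw [hg]
      exact Nat.le_add_left 4 _
    rw [Nat.le_div_iff_mul_le ht] at h4
    exact hy h4

/-- `(1 + A) Q = 1`. [cite: Andrews2022, Lemma 8 (proof)] -/
theorem one_add_A_mul_Q (k : ℕ) : (1 + A t c k) * Q t c k = 1 := by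
  have h : (1 + A t c k) * Q t c k = 1 - A t c k ^ 4 := by
    unfold Q
    noncomm_ring
  rw [h, A_pow_four, sub_zero]

/-- `1 + A` is upper unitriangular, so `det (1 + A) = 1`. [cite: Andrews2022, Lemma 8 (proof)] -/
theorem det_one_add_A (k : ℕ) : (1 + A t c k).det = 1 := by
  have htri : (1 + A t c k).BlockTriangular id := by
    intro x y hxy
    simp only [id] at hxy
    rw [Matrix.add_apply, Matrix.one_apply, if_neg (ne_of_gt hxy), zero_add]
    by_contra h
    have h1 := (upper_ne_zero (t := t) (c := c) (h : upper t c x y ≠ 0)).1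
    have ht : 0 < t := Nat.pos_of_ne_zero (NeZero.ne t)
    have hlt : (y : ℕ) < x := hxy
    have hdiv : (y : ℕ) / t ≤ (x : ℕ) / t := Nat.div_le_div_right hlt.le
    omega
  rw [Matrix.det_of_upperTriangular htri]
  refine Finset.prod_eq_one fun x _ => ?_
  rw [Matrix.add_apply, Matrix.one_apply_eq]
  have : A t c k x x = 0 := by
    by_contra h
    have h1 := (upper_ne_zero (t := t) (c := c) (h : upper t c x x ≠ 0)).1
    omega
  rw [this, add_zero]

/-- **First-order expansion of the leading minors**:
`det M_{[k]} = 1 + δ · tr(Q B) + δ² · r` for some polynomial `r`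
(`M = (1 + A)(1 + δ Q B)`, `det(1 + A) = 1`, and `det(1 + δ N) = 1 + δ tr N + O(δ²)`).
[cite: Andrews2022, Lemma 8 (proof)] -/
theorem det_M_eq (k : ℕ) : ∃ r : MvPolynomial (Var t) S,
    (M t c δ k).det = 1 + C δ * Matrix.trace (Q t c k * B S t k) + C δ ^ 2 * r := by
  have hfac : M t c δ k =
      (1 + A t c k) * (1 + (C δ : MvPolynomial (Var t) S) • (Q t c k * B S t k)) := by
    rw [Matrix.mul_add, Matrix.mul_one, Matrix.mul_smul, ← Matrix.mul_assoc, one_add_A_mul_Q,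
      Matrix.one_mul, M_eq]
  refine ⟨((1 + (Polynomial.X : Polynomial (MvPolynomial (Var t) S)) •
      (Q t c k * B S t k).map Polynomial.C).det.divX.divX).eval (C δ), ?_⟩
  rw [hfac, Matrix.det_mul, det_one_add_A, one_mul, Matrix.det_one_add_smul]
  ring

end TraceGadget

end Literature.Computability.AlgebraicComplexity
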